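import Literature.AlgebraicGeometry.AbelianSchemes.AbelianSchemeQuotientDescentOfUnitRigid
import Mathlib.FieldTheory.IsAlgClosed.AlgebraicClosure
import Mathlib.Algebra.Field.Equiv
import HarnessLib

/-!
# A line bundle on `(A/K)_T` trivial on `A_T` and on EVERY geometric fibre is trivial (HECKE-LINK D6, (K4) fibrewise form)

Layer `Literature/AlgebraicGeometry/AbelianSchemes`, namespace `Literature.AlgebraicGeometry.AbelianSchemes.AbelianSchemeOver`.
THEOREMS ONLY (no definition, no named fact, no instance).

Sequel to ★ (K4) `AbelianSchemeQuotientDescentOfUnitRigid` (B-p12 (g14), p749978).  Setting ([MumfordAV1970] §7 Thm. 4, §12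
Thm. 1, §15 Thm. 1): `A/S` an abelian scheme, `K ⊆ A(S)` a finite group of sections acting freely by translations; `ψ : A → A/K`
the quotient (★ `AbelianSchemeConstSubgroupQuotient`) and, for a test base `T′ → S`, its base change `ψ_T : A_T → (A/K)_T` — a free
affine flat geometric quotient for the `K`-translations (★ (u0) `AbelianSchemeQuotientBaseChangeAction`).  Let `M` be a line bundle
on `(A/K)_T` with `τ : ψ_T^* M ≅ 𝒪_{A_T}`.  By descent along `ψ_T` ([MumfordAV1970] §12 Thm. 1) the class of `M` is the CHARACTER
`σ ↦ ζ_σ ∈ Γ(T′, 𝒪)` by which `K` acts on the generator of `ψ_T^* M` (★ part 1 `AbelianSchemeQuotientDescentCharacter`, Stein).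
★ (K4) kills the character from triviality on ONE fibre plus CONNECTEDNESS of `T′` and `n` invertible (rigidity of roots of unity);
HERE the character is killed POINTWISE: if `M` is trivial on EVERY geometric fibre `(A/K)_{x̄}`, then `ζ_σ(x̄) = 1` at every geometric
point (★ `appTop_eq_one_of_fibre_iso_unit`), hence at every residue field (field extensions are injective), hence `ζ_σ = 1` because
`T′` is REDUCED (a global function which is `1` at every point of a reduced scheme is `1`, Mathlib `basicOpen_eq_bot_iff`) — no
connectedness, no torsion hypothesis, no invertibility of `n`.

* §0 `eq_one_of_forall_geometricPoint_appTop_eq_one` — a global function on a reduced scheme which is `1` at every geometric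
  point is `1`;
* §1 **`nonempty_iso_unit_of_pullback_quotientMk_iso_unit_of_forall_fibre`** — `ψ_T^* M ≅ 𝒪` and `M|_{(A/K)_{x̄}} ≅ 𝒪` for every
  geometric point `x̄` of `T′` (reduced, locally Noetherian) imply `M ≅ 𝒪` (proof = ★ (K4) verbatim with the rigidity line replaced
  by §0).

Consumer: the stabiliser inclusion `λ′_*K ≤ Stab(𝒩₁)` of the D6 `h4` ∃-package (`AbelianSchemeQuotientPoincareStabilizerOfMap`,
cell hodgecm-mathlib, B-p08 (g10) lead / B-p18 (g17)), where the test base is `S` itself (an open piece of `𝓜′_ℂ`, not connected in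
general).  Count-neutral; HC_CM is proved only modulo the 7 printed citations until rung 0 closes — nothing here is about HC.

## References
* [MumfordAV1970] D. Mumford, *Abelian Varieties* (1970), §7 Thm. 4 (p. 72), §12 Thm. 1 (p. 112), §15 Thm. 1 (p. 143).
* [MilneAV2008] J. S. Milne, *Abelian Varieties* (2008), I §8 (pp. 36–37), I §9 Thm. 9.1 (p. 42).
* [GortzWedhorn2020] U. Görtz, T. Wedhorn, *Algebraic Geometry I*, 2nd ed. (2020), Prop. 3.27 (1) and Exercise 2.2 (a scheme is
  reduced iff all `Γ(U, 𝒪_X)` are reduced; `D(f) = ∅` iff `f` is nilpotent) and Section (4.7).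
-/

set_option autoImplicit false

noncomputable section

-- `(A.X ⊗ T′).left = pullback A.X.hom T′.hom = (A.baseChange T′.hom).left` hold by `rfl` only.
set_option backward.isDefEq.respectTransparency false

universe u

open CategoryTheory CategoryTheory.Limits AlgebraicGeometry MonoidalCategory CartesianMonoidalCategory TopologicalSpace
  Opposite
open scoped MonObj

namespace Literature.AlgebraicGeometry.AbelianSchemes.AbelianSchemeOver

open Literature.AlgebraicGeometry.RelativeSpec Literature.AlgebraicGeometry.Modules Literature.AlgebraicGeometry.Motives
  Literature.AlgebraicGeometry.HodgeTheory Literature.AlgebraicGeometry.Morphisms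

/-! ## §0 Functions on a reduced scheme are determined by their values at geometric points -/

/-- **A global function `ζ` on a REDUCED scheme `X` with `x̄^♯ ζ = 1` for every geometric point `x̄ : Spec Ω → X` (`Ω` algebraically
closed) is `1`.**  At a point `t`, take `x̄ := Spec Ω̄ → Spec κ(t) → X` with `Ω̄` an algebraic closure of `κ(t)`: the map on global
sections `κ(t) = Γ(Spec κ(t)) → Γ(Spec Ω̄)` is injective (a ring map out of a field), so `ζ(t) = 1` in `κ(t)`; hence the basic open
set of `ζ - 1` is empty (Mathlib `Scheme.preimage_basicOpen_top`, `Scheme.fromSpecResidueField_apply`), and on a reduced scheme a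
section with empty basic open set vanishes (Mathlib `basicOpen_eq_bot_iff`). [cite: GortzWedhorn2020, Prop. 3.27 (1) and Exercise 2.2]
[cite: MumfordAV1970, §12 Thm. 1 (p. 112)] -/
theorem eq_one_of_forall_geometricPoint_appTop_eq_one (X : Scheme.{u}) [IsReduced X] (ζ : Γ(X, ⊤))
    (h : ∀ ⦃Ω : Type u⦄ [Field Ω] [IsAlgClosed Ω] (x : Spec (.of Ω) ⟶ X), x.appTop ζ = 1) : ζ = 1 := by
  -- at every residue field: `(X.fromSpecResidueField t)^♯ ζ = 1`
  have key : ∀ t : X, (X.fromSpecResidueField t).appTop ζ = 1 := by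
    intro t
    let Ω : Type u := AlgebraicClosure (X.residueField t)
    let φ : X.residueField t ⟶ CommRingCat.of Ω := CommRingCat.ofHom (algebraMap (X.residueField t) Ω)
    have h1 := h (Spec.map φ ≫ X.fromSpecResidueField t)
    rw [Scheme.Hom.comp_appTop, CommRingCat.comp_apply] at h1
    -- `Γ(Spec κ(t))` is a field, so `(Spec.map φ)^♯` is injective on global sections
    have hF : IsField Γ(Spec (X.residueField t), ⊤) :=
      MulEquiv.isField (Field.toIsField (X.residueField t))
        (Scheme.ΓSpecIso (X.residueField t)).commRingCatIsoToRingEquiv.toMulEquiv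
    letI := hF.toField
    haveI : Nontrivial Γ(Spec (CommRingCat.of Ω), ⊤) := nontrivial_ΓSpec_of_field Ω
    have hinj : Function.Injective (Spec.map φ).appTop.hom := RingHom.injective _
    apply hinj
    rw [map_one]
    exact h1
  -- hence the basic open set of `ζ - 1` is empty, and `X` is reduced
  have hbot : X.basicOpen (ζ - 1) = ⊥ := by
    ext t
    simp only [Opens.coe_bot, Set.mem_empty_iff_false, iff_false]
    intro ht
    have hpre : (X.fromSpecResidueField t) ⁻¹ᵁ X.basicOpen (ζ - 1) = ⊥ := by
      rw [Scheme.preimage_basicOpen_top, map_sub, map_one, key t, sub_self, Scheme.basicOpen_zero]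
    have hmem : IsLocalRing.closedPoint (X.residueField t) ∈ (X.fromSpecResidueField t) ⁻¹ᵁ X.basicOpen (ζ - 1) := by
      show (X.fromSpecResidueField t).base (IsLocalRing.closedPoint (X.residueField t)) ∈ (X.basicOpen (ζ - 1) : Set X)
      rw [Scheme.fromSpecResidueField_apply]
      exact ht
    rw [hpre] at hmem
    exact hmem
  exact sub_eq_zero.1 ((AlgebraicGeometry.basicOpen_eq_bot_iff (ζ - 1)).1 hbot)

/-! ## §1 The theorem -/

variable {S : Scheme.{u}} (A : AbelianSchemeOver S) (T' : Over S) {Y : Scheme.{u}} (u : S ⟶ Y)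
  (K : Subgroup A.Sections)
  [Finite K] [Y.IsSeparated] [IsSeparated (A.X.hom ≫ u)] [S.IsSeparated]
  (hcov : ∀ x : A.left, ∃ O : (A.translationActionOver u K).StableAffineOpens, x ∈ O.1)
  (hfree : ∀ (Ω : Type u) [Field Ω] [IsAlgClosed Ω] (x : Spec (.of Ω) ⟶ A.left) (σ : K), σ ≠ 1 →
    x ≫ (A.translation (σ : A.Sections)).left ≠ x)

include hfree in
/-- **A line bundle on `(A/K)_T` which is trivial on `A_T` and on EVERY geometric fibre is trivial** (HECKE-LINK D6, (K4)
fibrewise form).  Let `T′ → S` be reduced and locally Noetherian, `K ⊆ A(S)` finite and free, `M` a line bundle on `(A/K) ×_S T′`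
with `ψ_T^* M ≅ 𝒪` and `M|_{(A/K)_{x̄}} ≅ 𝒪` for every geometric point `x̄ : Spec Ω → T′`.  Then `M ≅ 𝒪`: the `K`-character of
`M` (values in `Γ(T′, 𝒪)`, ★ `exists_actSections_inv_app_one_eq_smul` + Stein) is `1` at every geometric point (★
`appTop_eq_one_of_fibre_iso_unit`), hence `1` (§0, `T′` reduced), so the generator of `ψ_T^* M` is invariant and ★
`nonempty_iso_unit_of_actSections_eq` applies — ★ (K4) `nonempty_iso_unit_of_pullback_quotientMk_iso_unit` VERBATIM with its
one-point rigidity line replaced by §0 (no connectedness, no `n`). [cite: MumfordAV1970, §12 Thm. 1 (p. 112)]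
[cite: MumfordAV1970, §15 Thm. 1 (p. 143)] [cite: MilneAV2008, I §9 Thm. 9.1 (p. 42)] -/
theorem nonempty_iso_unit_of_pullback_quotientMk_iso_unit_of_forall_fibre [IsAffine Y] [IsReduced T'.left]
    [IsLocallyNoetherian T'.left]
    (M : ((A.quotientOver u K ⊗ T').left).Modules) (hM : HasRank M 1)
    (τ : (Scheme.Modules.pullback (A.quotientMk u K hcov ▷ T').left).obj M ≅ SheafOfModules.unit _)
    (hx : ∀ ⦃k : Type u⦄ [Field k] [IsAlgClosed k] (x : Spec (.of k) ⟶ T'.left),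
      Nonempty ((Scheme.Modules.pullback
        (A.quotientOver u K ◁ (Over.homMk x rfl : Over.mk (x ≫ T'.hom) ⟶ T')).left).obj M ≅ SheafOfModules.unit _)) :
    Nonempty (M ≅ SheafOfModules.unit _) := by
  haveI : Fintype K := Fintype.ofFinite K
  -- the generator `s = τ⁻¹(1)` of `ψ_T^* M` is invariant
  have hinv : ∀ g : K, (translationActionOverWhiskerRight A T' u K hcov).actSections _
      (ActionOver.EquivariantStructure.ofPullback (translationActionOverWhiskerRight A T' u K hcov) M).iso g ⊤
      (τ.inv.app ((A.quotientMk u K hcov ▷ T').left ⁻¹ᵁ ⊤)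
        (1 : Γ((A.X ⊗ T').left, (A.quotientMk u K hcov ▷ T').left ⁻¹ᵁ ⊤))) =
      τ.inv.app ((A.quotientMk u K hcov ▷ T').left ⁻¹ᵁ ⊤)
        (1 : Γ((A.X ⊗ T').left, (A.quotientMk u K hcov ▷ T').left ⁻¹ᵁ ⊤)) := by
    intro g
    obtain ⟨a, ha⟩ := A.exists_actSections_inv_app_one_eq_smul T' u K hcov M τ g
    -- `a = ψ_T^♯ pr^♯ ζ` (Stein)
    obtain ⟨ζ, hζ⟩ := ((A.baseChange T'.hom).appTop_bijective_of_isReduced).2 a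
    have ha' : a = (A.quotientMk u K hcov ▷ T').left.app ⊤ ((pullback.snd (A.quotientOver u K).hom T'.hom).appTop ζ) := by
      rw [← hζ]
      change _ = ((A.quotientMk u K hcov ▷ T').left ≫ pullback.snd (A.quotientOver u K).hom T'.hom).appTop ζ
      rw [Over.whiskerRight_left_snd]
      rfl
    -- `ζ(x̄) = 1` at EVERY geometric point `x̄` of `T′` (★ Step 2 at the point), hence `ζ = 1` on the REDUCED `T′`
    rw [ha'] at ha
    have hζ1 : ζ = 1 :=
      eq_one_of_forall_geometricPoint_appTop_eq_one T'.left ζ fun k _ _ x =>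
        A.appTop_eq_one_of_fibre_iso_unit T' u K hcov M τ x hM g ζ ha (hx x)
    rw [ha, hζ1, map_one, map_one, one_smul]
  -- assembly: ★ `nonempty_iso_unit_of_actSections_eq` with `e : ψ_T^* 𝒪 ≅ 𝒪 ≅ ψ_T^* M`
  haveI : IsIso (C := (A.X ⊗ T').left.Modules)
      (SheafOfModules.pullbackObjUnitToUnit (A.quotientMk u K hcov ▷ T').left.toRingCatSheafHom) := by
    haveI := Literature.AlgebraicGeometry.KTheory.final_opensMap (A.quotientMk u K hcov ▷ T').left
    exact SheafOfModules.instIsIsoPullbackObjUnitToUnitOfFinal _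
  haveI := A.flat_whiskerRight_quotientMk_left T' u K hcov hfree
  haveI := isAffineHom_whiskerRight_quotientMk_left A T' u K hcov
  haveI : ((Scheme.Modules.pullback (A.quotientMk u K hcov ▷ T').left).obj M).IsQuasicoherent :=
    isQuasicoherent_of_hasRank (hasRank_pullback _ hM)
  refine (translationActionOverWhiskerRight A T' u K hcov).nonempty_iso_unit_of_actSections_eq
    (isGeometricQuotient_translationActionOverWhiskerRight A T' u K hcov hfree)
    (translationActionOverWhiskerRight_free A T' u K hcov hfree) M
    (asIso (C := (A.X ⊗ T').left.Modules)
      (SheafOfModules.pullbackObjUnitToUnit (A.quotientMk u K hcov ▷ T').left.toRingCatSheafHom) ≪≫ τ.symm) ?_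
  intro g
  have he : ((asIso (C := (A.X ⊗ T').left.Modules)
      (SheafOfModules.pullbackObjUnitToUnit (A.quotientMk u K hcov ▷ T').left.toRingCatSheafHom) ≪≫ τ.symm).hom.app
        ((A.quotientMk u K hcov ▷ T').left ⁻¹ᵁ ⊤)
        (Literature.AlgebraicGeometry.Modules.unitSection (A.quotientMk u K hcov ▷ T').left (SheafOfModules.unit _) ⊤
          (1 : Γ((A.quotientOver u K ⊗ T').left, ⊤)))) =
      τ.inv.app ((A.quotientMk u K hcov ▷ T').left ⁻¹ᵁ ⊤)
        (1 : Γ((A.X ⊗ T').left, (A.quotientMk u K hcov ▷ T').left ⁻¹ᵁ ⊤)) := by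
    change τ.inv.app _ (Scheme.Modules.Hom.app
      (SheafOfModules.pullbackObjUnitToUnit (A.quotientMk u K hcov ▷ T').left.toRingCatSheafHom) _
        (Literature.AlgebraicGeometry.Modules.unitSection (A.quotientMk u K hcov ▷ T').left (SheafOfModules.unit _) ⊤
          (1 : Γ((A.quotientOver u K ⊗ T').left, ⊤)))) = _
    rw [ActionOver.pullbackObjUnitToUnit_app_unitSection]
    exact congrArg _ (map_one ((A.quotientMk u K hcov ▷ T').left.app ⊤).hom)
  exact (congrArg (fun t => (translationActionOverWhiskerRight A T' u K hcov).actSections _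
    (ActionOver.EquivariantStructure.ofPullback (translationActionOverWhiskerRight A T' u K hcov) M).iso g ⊤ t) he).trans
    ((hinv g).trans he.symm)

end Literature.AlgebraicGeometry.AbelianSchemes.AbelianSchemeOver

end
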